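import Mathlib
import Summits.ResolutionOfSingularities.ResolutionOfSingularities.Theorems.RadicialJungCleanModelsCleanSeqOpenTransport
import HarnessLib

/-!
# Route `RadicialJung`, crux `CleanModels` (stmt-ResolutionOfSingularities-15917), line `Sketch` rev 35, stub 6 `stub_cleanProp44` (X44c):
# CLEAN PATCHING II — relative extension of a clean-permissible sequence from an open subscheme

Work item (W1) «clean patching» of the memo `Cruxes/CleanModels/Lines/Sketch-memo-4e-cleanPermissible.md` §7, second file: the clean twin of
✓ `CampaignW46.IsPermissibleBlowupSeq.exists_extension_of_isOpenImmersion_rel` (`MarkedTransferCampaignW46ThreefoldsGammaFreeGlobalPatching.lean`)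
in the output currency `IsCleanPermissibleSeq` of X44c.

* `ne_bot_of_isBlowup` — the centre of a blowing up with non-empty integral source is not the zero ideal.
* `IsCleanPermissibleSeq.exists_extension_of_isOpenImmersion_rel` — **RELATIVE EXTENSION.**  `X` integral locally Noetherian, `u : V → X` an open
  immersion (`V` integral), `Z ⊆ u(V)` closed in `X` such that every point OF `u(V)` of order `≥ μ` for `J` lies in `Z`.  Every clean-permissible
  sequence `σ : V' → V` for `(u^*J, μ)` and the line of `u^♯ G`, with last transform `K'`, is the restriction of a clean-permissible sequence
  `Φ : X' → X` for `(J, μ)` and the line of `G` with last transform `J'`, along an open immersion `u' : V' → X'` (`u' ≫ Φ = σ ≫ u`, `K' = u'^*J'`),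
  such that (a) every point of the image of `u'` of order `≥ μ` for `J'` lies over `Z`; (b) every point over `Z` is in the image of `u'`; (c) over
  `O := X ∖ Z` nothing happens: `Φ⁻¹ O ↪ X' → X` is an open immersion and (d) `J'|_{Φ⁻¹ O}` is the pull-back of `J`.  Mechanism as in the W4.6
  file — blow up `X_i` along the image of the centre (closed, because it lies over `Z`; INTEGRAL as the image of an irreducible set; regular;
  inside `{ord = μ}` by ✓ `idealOrder_comap_of_etale`) — plus CLEAN-PERMISSIBILITY of that centre by DESCENT along `u_i`
  (✓ `CleanPermissibleAt.of_functionFieldMap_of_isIso_stalkMap`); transforms match by ✓ `comap_controlledTransform_of_flat` (no regularity needed).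

Honest framing: OURS (glue, any dimension); nothing here proves X44c, any case of `CleanModels`, or resolution of singularities in characteristic `p`.
-/

noncomputable section

set_option linter.dupNamespace false -- mandated namespace of this single-conjunct summit

open CategoryTheory CategoryTheory.Limits AlgebraicGeometry TopologicalSpace IsLocalRing
open Literature.AlgebraicGeometry.Resolution Literature.AlgebraicGeometry.Motives
open Scheme.IdealSheafData

namespace Summit.ResolutionOfSingularities.ResolutionOfSingularities.Theorems.RadicialJung.CleanModels

/-- The centre of a blowing up whose source is a (non-empty) integral scheme is not the zero ideal sheaf (else its pull-back `0` would be an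
effective Cartier divisor). [cite: GortzWedhorn2020, Def. 13.90] -/
theorem ne_bot_of_isBlowup {X' X : Scheme.{0}} [IsIntegral X'] {π : X' ⟶ X} {I : X.IdealSheafData} (hπ : IsBlowup π I) : I ≠ ⊥ := by
  rintro rfl
  have hE := hπ.isEffectiveCartier
  rw [Scheme.IdealSheafData.comap_bot] at hE
  exact not_isEffectiveCartier_bot_of_isIntegral hE

/-- **RELATIVE EXTENSION of a clean-permissible sequence from an open subscheme** (clean twin of
✓ `CampaignW46.IsPermissibleBlowupSeq.exists_extension_of_isOpenImmersion_rel`).  See the module docstring; the sequence on `V` is stated with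
free indices `JV, μ', GV` tied to `u^*J, μ, u^♯G` by equations, so that the induction on it goes through.
[cite: Piltant2013, Prop. 5.1 (proof, Step 2)] [cite: GortzWedhorn2020, Prop. 13.91 (2)] -/
theorem IsCleanPermissibleSeq.exists_extension_of_isOpenImmersion_rel {p : ℕ} {X : Scheme.{0}} [IsIntegral X] [IsLocallyNoetherian X]
    (J : X.IdealSheafData) (μ : ℕ) (G : X.functionField) (Z : Set X) (hZ : IsClosed Z) :
    ∀ {V' V : Scheme.{0}} [IsIntegral V'] [IsIntegral V] {σ : V' ⟶ V} [IsDominant σ] {JV : V.IdealSheafData} {μ' : ℕ}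
      {K' : V'.IdealSheafData} {GV : V.functionField}, IsCleanPermissibleSeq p σ JV μ' K' GV →
      ∀ (u : V ⟶ X) [IsOpenImmersion u] [IsDominant u], JV = J.comap u → μ' = μ → GV = RatFn.functionFieldMap u G →
      (∀ y : V, (μ : ℕ∞) ≤ idealOrder J (u y) → u y ∈ Z) → Z ⊆ Set.range u →
      ∃ (X' : Scheme.{0}) (_ : IsIntegral X') (Φ : X' ⟶ X) (_ : IsDominant Φ) (J' : X'.IdealSheafData) (u' : V' ⟶ X'),
        IsCleanPermissibleSeq p Φ J μ J' G ∧ IsOpenImmersion u' ∧ u' ≫ Φ = σ ≫ u ∧ K' = J'.comap u' ∧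
        (∀ y' : V', (μ : ℕ∞) ≤ idealOrder J' (u' y') → Φ (u' y') ∈ Z) ∧
        (∀ x' : X', Φ x' ∈ Z → x' ∈ Set.range u') ∧
        IsOpenImmersion ((Φ ⁻¹ᵁ ⟨Zᶜ, hZ.isOpen_compl⟩).ι ≫ Φ) ∧
        J'.comap (Φ ⁻¹ᵁ ⟨Zᶜ, hZ.isOpen_compl⟩).ι = J.comap ((Φ ⁻¹ᵁ ⟨Zᶜ, hZ.isOpen_compl⟩).ι ≫ Φ) ∧
        IsLocallyNoetherian X' := by
  intro V' V _ _ σ _ JV μ' K' GV h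
  induction h with
  | nil JV μ' GV =>
    intro u _ _ hJV hμ _ hJZ hZu
    subst hJV hμ
    refine ⟨X, inferInstance, 𝟙 X, inferInstance, J, u, IsCleanPermissibleSeq.nil J μ' G, inferInstance, by simp, rfl,
      fun y hy => hJZ y (by simpa using hy), fun x hx => hZu (by simpa using hx), ?_, ?_, inferInstance⟩
    · rw [Category.comp_id]; infer_instance
    · rw [Category.comp_id]
  | @cons V₂ V₁ V _ _ _ τ _ σ₁ _ JV μ' K₁ GV Y hσ₁ hYint hYreg hY hτ hperm ih =>
    intro u _ _ hJV hμ hGV hJZ hZu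
    obtain ⟨X₁, hX₁, Φ₁, hΦ₁, J₁, u₁, hseq₁, hu₁, hcomm₁, hK₁, ha₁, hb₁, hopen₁, hJO₁, hN₁⟩ := ih u hJV hμ hGV hJZ hZu
    subst hJV hμ hGV
    haveI := hX₁
    haveI := hΦ₁
    haveI := hu₁
    haveI := hN₁
    haveI : IsLocallyNoetherian V₁ := LocallyOfFiniteType.isLocallyNoetherian u₁
    haveI : IsDominant u₁ := isDominant_of_isOpenImmersion u₁
    set O : X.Opens := ⟨Zᶜ, hZ.isOpen_compl⟩ with hO
    -- orders on `V₁` are orders on `X₁`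
    have hordu : ∀ y : V₁, idealOrder K₁ y = idealOrder J₁ (u₁ y) := fun y => by
      rw [hK₁]; exact idealOrder_comap_of_etale u₁ J₁ y
    -- the image of the centre lies over `Z`, hence is closed in `X₁`
    have himZ : ∀ y ∈ (Y : Set V₁), Φ₁ (u₁ y) ∈ Z := fun y hy =>
      ha₁ y (by rw [← hordu, hY y hy])
    have hcl : closure (u₁ '' (Y : Set V₁)) = u₁ '' (Y : Set V₁) := by
      refine Set.Subset.antisymm (fun x hx => ?_) subset_closure
      have hxZ : Φ₁ x ∈ Z := by
        have hsub : closure (u₁ '' (Y : Set V₁)) ⊆ Φ₁ ⁻¹' Z :=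
          closure_minimal (by rintro _ ⟨y, hy, rfl⟩; exact himZ y hy) (hZ.preimage Φ₁.continuous)
        exact hsub hx
      obtain ⟨y, rfl⟩ := hb₁ x hxZ
      have hy : y ∈ ((closureImage u₁ (Y : Set V₁)).preimage u₁.continuous : Set V₁) := hx
      rw [preimage_closureImage_eq] at hy
      exact ⟨y, hy, rfl⟩
    -- the centre on `X₁`: the reduced closed subscheme on `u₁(Y)`
    set DX : Closeds X₁ := closureImage u₁ (Y : Set V₁) with hDX
    have hDXcoe : (DX : Set X₁) = u₁ '' (Y : Set V₁) := by rw [hDX, coe_closureImage, hcl]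
    set C : X₁.IdealSheafData := vanishingIdeal DX with hCdef
    have hC : C.comap u₁ = vanishingIdeal Y := comap_vanishingIdeal_closureImage u₁ Y
    -- it is integral, regular, inside `{ord = μ}`, and non-zero
    have hDXint : IsIntegral (vanishingIdeal DX).subscheme := by
      refine ComponentGluing.isIntegral_subscheme_vanishingIdeal DX ?_
      rw [hDXcoe]
      exact (isIrreducible_of_isIntegral_subscheme_vanishingIdeal Y hYint).image _ u₁.continuous.continuousOn
    have hregX : Scheme.IsRegular (vanishingIdeal DX).subscheme := by
      refine CampaignW46.isRegular_subscheme_of_support_subset_range u₁ C (fun x hx => ?_) (by rw [hC]; exact hYreg)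
      rw [hCdef, Scheme.IdealSheafData.coe_support_vanishingIdeal, hDXcoe] at hx
      obtain ⟨y, -, rfl⟩ := hx
      exact ⟨y, rfl⟩
    have hDXord : ∀ x ∈ (DX : Set X₁), idealOrder J₁ x = μ' := by
      intro x hx
      rw [hDXcoe] at hx
      obtain ⟨y, hy, rfl⟩ := hx
      rw [← hordu]
      exact hY y hy
    have hC0 : C ≠ ⊥ := by
      intro hC0
      apply ne_bot_of_isBlowup hτ
      rw [← hC, hC0, Scheme.IdealSheafData.comap_bot]
    have hCsupp : (C.support : Set X₁) = u₁ '' (Y : Set V₁) := by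
      rw [hCdef, Scheme.IdealSheafData.coe_support_vanishingIdeal, hDXcoe]
    -- the centre misses `Φ₁⁻¹ O`
    have hdisj : Disjoint ((Φ₁ ⁻¹ᵁ O : X₁.Opens) : Set X₁) (C.support : Set X₁) := by
      rw [Set.disjoint_left]
      intro x hxO hxC
      rw [hCdef, Scheme.IdealSheafData.coe_support_vanishingIdeal, hDXcoe] at hxC
      obtain ⟨y, hy, rfl⟩ := hxC
      exact hxO (himZ y hy)
    -- clean-permissibility of the centre on `X₁`: DESCENT along `u₁`
    have hpermX : ∀ x ∈ (DX : Set X₁), CleanPermissibleAt p (algebraMap (X₁.presheaf.stalk x) X₁.functionField)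
        (RatFn.functionFieldMap Φ₁ G) (stalkIdeal (vanishingIdeal DX) x) := by
      intro x hx
      rw [hDXcoe] at hx
      obtain ⟨y, hy, rfl⟩ := hx
      haveI : IsIso (u₁.stalkMap y) := (IsOpenImmersion.iff_isIso_stalkMap.mp inferInstance).2 y
      refine CleanPermissibleAt.of_functionFieldMap_of_isIso_stalkMap u₁ (RatFn.functionFieldMap_bijective_of_isOpenImmersion u₁) y C ?_
      have h1 := hperm y hy
      rw [← RingHom.comp_apply, ← RatFn.functionFieldMap_comp, ← Picover.FunctionFieldNormalizationIn.functionFieldMap_congr hcomm₁,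
        RatFn.functionFieldMap_comp, RingHom.comp_apply, ← hC] at h1
      exact h1
    -- blow up `X₁` along it: a clean-permissible step of the global sequence
    set πX := blowup.π C with hπXdef
    have hπX : IsBlowup πX C := blowup.isBlowup _
    haveI : IsIntegral (blowup C) := hπX.isIntegral hC0
    haveI : IsDominant πX := isDominant_of_isBlowup_of_ne_bot hπX hC0
    haveI : IsProper πX := hπX.isProper
    haveI : IsLocallyNoetherian (blowup C) := LocallyOfFiniteType.isLocallyNoetherian πX
    have hstep : IsCleanPermissibleSeq p (πX ≫ Φ₁) J μ' (controlledTransform πX (vanishingIdeal DX) J₁ μ') G :=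
      IsCleanPermissibleSeq.cons πX Φ₁ J μ' J₁ G DX hseq₁ hDXint hregX hDXord hπX hpermX
    -- the blowing up of `V₁` maps into it as an open subscheme (GW 13.91 (2))
    have hτ' : IsBlowup τ (C.comap u₁) := by rw [hC]; exact hτ
    let u₂ : V₂ ⟶ blowup C := hπX.lift (τ ≫ u₁)
      (by rw [Scheme.IdealSheafData.comap_comp]; exact hτ'.isEffectiveCartier)
    have hu₂π : u₂ ≫ πX = τ ≫ u₁ := hπX.lift_comp _ _
    have hsq : IsPullback u₂ τ πX u₁ := hπX.isPullback_of_isOpenImmersion u₁ hτ' hu₂π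
    haveI : IsOpenImmersion u₂ := MorphismProperty.of_isPullback hsq.flip inferInstance
    haveI : IsProper τ := hτ.isProper
    haveI : IsLocallyNoetherian V₂ := LocallyOfFiniteType.isLocallyNoetherian τ
    -- transforms match along `u₂`
    have hK₂ : controlledTransform τ (vanishingIdeal Y) K₁ μ' = (controlledTransform πX (vanishingIdeal DX) J₁ μ').comap u₂ := by
      rw [comap_controlledTransform_of_flat u₁ hu₂π (vanishingIdeal DX) J₁ μ', ← hCdef, hC, ← hK₁]
    -- over `O` the new blowing up is an isomorphism
    haveI hiso : IsIso (πX ∣_ (Φ₁ ⁻¹ᵁ O)) := hπX.isIso_morphismRestrict hdisj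
    have hfac : (πX ⁻¹ᵁ (Φ₁ ⁻¹ᵁ O)).ι ≫ πX ≫ Φ₁ = (πX ∣_ (Φ₁ ⁻¹ᵁ O)) ≫ ((Φ₁ ⁻¹ᵁ O).ι ≫ Φ₁) := by
      rw [← Category.assoc, ← morphismRestrict_ι, Category.assoc]
    haveI hopen₂ : IsOpenImmersion ((πX ∣_ (Φ₁ ⁻¹ᵁ O)) ≫ ((Φ₁ ⁻¹ᵁ O).ι ≫ Φ₁)) :=
      @IsOpenImmersion.comp _ _ _ (πX ∣_ (Φ₁ ⁻¹ᵁ O)) ((Φ₁ ⁻¹ᵁ O).ι ≫ Φ₁) inferInstance hopen₁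
    refine ⟨blowup C, inferInstance, πX ≫ Φ₁, inferInstance, controlledTransform πX (vanishingIdeal DX) J₁ μ', u₂, hstep, inferInstance,
      by rw [← Category.assoc, hu₂π, Category.assoc, hcomm₁, Category.assoc], hK₂, fun y₂ hy₂ => ?_,
      fun x₂ hx₂ => ?_, ?_, ?_, inferInstance⟩
    · -- (a) points of the image of order `≥ μ` lie over `Z`
      rw [Scheme.Hom.comp_apply]
      by_cases hmem : πX (u₂ y₂) ∈ (C.support : Set X₁)
      · rw [hCsupp] at hmem
        obtain ⟨y, hy, hyx⟩ := hmem
        rw [← hyx]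
        exact himZ y hy
      · rw [hπX.idealOrder_controlledTransform_of_not_mem J₁ μ' hmem] at hy₂
        have h1 : πX (u₂ y₂) = u₁ (τ y₂) := by
          rw [← Scheme.Hom.comp_apply, hu₂π, Scheme.Hom.comp_apply]
        rw [h1] at hy₂ ⊢
        exact ha₁ (τ y₂) hy₂
    · -- (b) points over `Z` lie in the image of `u₂ = u₁ ×_{X₁} X₂`
      rw [Scheme.Hom.comp_apply] at hx₂
      obtain ⟨y, hy⟩ := hb₁ _ hx₂
      obtain ⟨z, hz, -⟩ := Scheme.Pullback.exists_preimage_pullback x₂ y hy.symm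
      refine ⟨(hsq.isoPullback).inv z, ?_⟩
      rw [← hz, ← Scheme.Hom.comp_apply, IsPullback.isoPullback_inv_fst]
    · -- (c) open immersion over `O`
      change IsOpenImmersion ((πX ⁻¹ᵁ (Φ₁ ⁻¹ᵁ O)).ι ≫ πX ≫ Φ₁)
      rw [hfac]
      exact hopen₂
    · -- (d) the transform over `O` is the pull-back
      have hsqO : (πX ⁻¹ᵁ (Φ₁ ⁻¹ᵁ O)).ι ≫ πX = (πX ∣_ (Φ₁ ⁻¹ᵁ O)) ≫ (Φ₁ ⁻¹ᵁ O).ι :=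
        (morphismRestrict_ι _ _).symm
      have hCO : (vanishingIdeal DX).comap (Φ₁ ⁻¹ᵁ O).ι = ⊤ := by
        rw [← Scheme.IdealSheafData.support_eq_bot_iff, Scheme.IdealSheafData.support_comap]
        ext x
        simp only [Closeds.coe_preimage, Set.mem_preimage, Closeds.coe_bot, Set.mem_empty_iff_false, iff_false]
        intro hx
        exact Set.disjoint_left.mp hdisj x.2 hx
      change (controlledTransform πX (vanishingIdeal DX) J₁ μ').comap (πX ⁻¹ᵁ (Φ₁ ⁻¹ᵁ O)).ι =
        J.comap ((πX ⁻¹ᵁ (Φ₁ ⁻¹ᵁ O)).ι ≫ πX ≫ Φ₁)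
      rw [comap_controlledTransform_of_flat (Φ₁ ⁻¹ᵁ O).ι hsqO (vanishingIdeal DX) J₁ μ', hCO,
        CampaignW46.controlledTransform_top, hJO₁, ← Scheme.IdealSheafData.comap_comp, hfac]

/-- **The relative extension read from a clean-permissible sequence on an open immersion `u : V → X` for `(u^*J, μ, u^♯G)` directly**
(the equations of `exists_extension_of_isOpenImmersion_rel` discharged by `rfl`). [cite: Piltant2013, Prop. 5.1 (proof, Step 2)] -/
theorem IsCleanPermissibleSeq.exists_extension_of_isOpenImmersion_rel' {p : ℕ} {X : Scheme.{0}} [IsIntegral X] [IsLocallyNoetherian X]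
    (J : X.IdealSheafData) (μ : ℕ) (G : X.functionField) (Z : Set X) (hZ : IsClosed Z) {V' V : Scheme.{0}} [IsIntegral V']
    [IsIntegral V] (u : V ⟶ X) [IsOpenImmersion u] [IsDominant u] {σ : V' ⟶ V} [IsDominant σ] {K' : V'.IdealSheafData}
    (h : IsCleanPermissibleSeq p σ (J.comap u) μ K' (RatFn.functionFieldMap u G))
    (hJZ : ∀ y : V, (μ : ℕ∞) ≤ idealOrder J (u y) → u y ∈ Z) (hZu : Z ⊆ Set.range u) :
    ∃ (X' : Scheme.{0}) (_ : IsIntegral X') (Φ : X' ⟶ X) (_ : IsDominant Φ) (J' : X'.IdealSheafData) (u' : V' ⟶ X'),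
      IsCleanPermissibleSeq p Φ J μ J' G ∧ IsOpenImmersion u' ∧ u' ≫ Φ = σ ≫ u ∧ K' = J'.comap u' ∧
      (∀ y' : V', (μ : ℕ∞) ≤ idealOrder J' (u' y') → Φ (u' y') ∈ Z) ∧
      (∀ x' : X', Φ x' ∈ Z → x' ∈ Set.range u') ∧
      IsOpenImmersion ((Φ ⁻¹ᵁ ⟨Zᶜ, hZ.isOpen_compl⟩).ι ≫ Φ) ∧
      J'.comap (Φ ⁻¹ᵁ ⟨Zᶜ, hZ.isOpen_compl⟩).ι = J.comap ((Φ ⁻¹ᵁ ⟨Zᶜ, hZ.isOpen_compl⟩).ι ≫ Φ) ∧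
      IsLocallyNoetherian X' :=
  h.exists_extension_of_isOpenImmersion_rel J μ G Z hZ u rfl rfl rfl hJZ hZu

end Summit.ResolutionOfSingularities.ResolutionOfSingularities.Theorems.RadicialJung.CleanModels

end
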